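import Literature.NumberTheory.Rogawski1990.SingularLocalConjugacy
import Literature.NumberTheory.Automorphic.UnitaryGroupSplitPlace
import HarnessLib

/-!
# Local conjugacy at a SINGULAR semisimple class, II: SPLIT places — invertible hermitian forms of equal rank over `E_v = E_w × E_w̄` are
# ALL congruent, so the `γ`-centralising congruence of ★ `SingularLocalConjugacy` needs no determinant condition (Rogawski 1990, §3.8)

Topic `NumberTheory/Rogawski1990`; namespace `Literature.NumberTheory.Rogawski1990`.  THEOREMS ONLY (no definition, no named fact, no instance,
no notation, no `sorry`).  Cell `pub/hodgecm-mathlib`, ENGINE T1 (crux H413 = `stmt-HodgeConjecture-24833`), row O7 «singular semisimple classes»,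
piece **(h2) «SPLIT finite `v`»** of F0P5a-p03's TRUNK WORDS #7 (A-p01 (g15) O7 OWNER WORD #12; F0P5-p01 (g8)) = the split-place twin of ★ B-p14
FILE B `SingularLocalConjugacy` §2 (which treats the NON-split places, where the rank-2 block's determinant class mod norms decides).

THE MATHEMATICS.  At a place `v` of `F` that SPLITS in `E` the local ring `E_v = E ⊗_F F_v = ∏_{w ∣ v} E_w` has exactly two factors `E_w`, `E_w̄`
(★ `PlacesOver.eq_or_eq_galInv`, `PlacesOver.galInv_ne`) swapped by `σ = c ⊗ 1` (★ `conjLocal`).  The indicator `e` of the factor `w` is a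
**split idempotent**: `e² = e`, `σ(e) = 1 − e` (§2 `exists_split_idempotent`).  §1 is the ring-generic consequence: for ANY commutative ring `R`
with an endomorphism `σ` and a split idempotent `e`, every `σ`-hermitian invertible `G ∈ M_n(R)` is a «norm», `G = ᵗ(σs) s` with
`s := e·1 + (1 − e)·G ∈ GL_n(R)` (`exists_units_twistGram_one_eq`), hence ANY TWO `σ`-hermitian invertible matrices of the same size are congruent
(`exists_units_twistGram_eq_of_split_idempotent`) and every `σ`-fixed unit is `σ(z) z` (`exists_isUnit_map_mul_self_eq_of_split_idempotent`) —
«at a split place `U(G)(F_v) ≅ GL_n(E_w)` and hermitian forms have no invariants» [Rogawski1990, §3.8 p. 30: `𝓡(T∕F_v)` is trivial at split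
`v`; Mok2014 §1: `U(N)(F_v) ≅ GL_N(F_v)`].  §3 plugs the rank-`2` and rank-`1` congruences into ★ `exists_commute_twistGram_eq_of_blocks`: the
(h1)-shaped sockets **`exists_commute_twistGram_eq_of_split`** and **`exists_unitary_conj_of_split_frame`** with the NON-split hypotheses
`hdet₁ hdet₂` of ★ `exists_commute_twistGram_eq_of_det_blocks` ∕ `exists_unitary_conj_of_det_blocks` simply ABSENT.
HC_CM is proved only modulo the printed citations until rung 0 closes; this file discharges none of them.

## References
* [Rogawski1990] J. D. Rogawski, *Automorphic Representations of Unitary Groups in Three Variables*, Ann. of Math. Stud. 123 (1990), §3.1 p. 19,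
  §3.8 Prop. 3.8.1 (d) p. 30.
* [Mok2014] C. P. Mok, *Endoscopic classification of representations of quasi-split unitary groups*, Mem. AMS 235 (2015), §1 Notation p. 5.
* [Kottwitz1986] R. E. Kottwitz, *Stable trace formula: elliptic singular terms*, Math. Ann. 275 (1986), §7.
-/

set_option autoImplicit false

noncomputable section

open NumberField IsDedekindDomain Matrix
open scoped MatrixGroups

namespace Literature.NumberTheory.Rogawski1990

open Literature.NumberTheory.Automorphic
open Literature.NumberTheory.Automorphic.UnitaryGroup (finSum transpose_finSum_map det_finSum)
open Literature.AlgebraicGeometry.ShimuraVarieties (unitaryGroup)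

/-! ## §1 Ring-generic: a split idempotent makes all invertible hermitian forms congruent -/

section SplitIdempotent

variable {R : Type*} [CommRing R] (σ : R →+* R) {n : Type*} [Fintype n] [DecidableEq n]

/-- The «norm» candidate: for `e² = e`, `σ e = 1 − e` and `G` σ-hermitian, `s := e·1 + (1−e)·G` satisfies `ᵗ(σs) s = G`.
[cite: Rogawski1990, §3.8 Prop. 3.8.1 (d) p. 30] -/
theorem transpose_map_mul_self_of_split_idempotent {e : R} (he : e * e = e) (hσe : σ e = 1 - e) {G : Matrix n n R} (hG : (G.map σ)ᵀ = G) :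
    ((e • (1 : Matrix n n R) + (1 - e) • G).map σ)ᵀ * (e • (1 : Matrix n n R) + (1 - e) • G) = G := by
  have hσe' : σ (1 - e) = e := by rw [map_sub, map_one, hσe, sub_sub_cancel]
  have h1 : (1 - e) * e = 0 := by rw [sub_mul, one_mul, he, sub_self]
  have h2 : e * (1 - e) = 0 := by rw [mul_sub, mul_one, he, sub_self]
  have h3 : (1 - e) * (1 - e) = 1 - e := by rw [mul_sub, mul_one, sub_mul, one_mul, he, sub_self, sub_zero]
  have hmap : (e • (1 : Matrix n n R) + (1 - e) • G).map σ = (1 - e) • (1 : Matrix n n R) + e • G.map σ := by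
    rw [Matrix.map_add σ (map_add σ), Matrix.map_smul' _ _ _ (map_mul σ), Matrix.map_smul' _ _ _ (map_mul σ), hσe, hσe',
      Matrix.map_one _ (map_zero σ) (map_one σ)]
  rw [hmap, Matrix.transpose_add, Matrix.transpose_smul, Matrix.transpose_smul, Matrix.transpose_one, hG, Matrix.add_mul, Matrix.mul_add,
    Matrix.mul_add, Matrix.smul_mul, Matrix.smul_mul, Matrix.smul_mul, Matrix.smul_mul, Matrix.mul_smul, Matrix.mul_smul, Matrix.mul_smul,
    Matrix.mul_smul, Matrix.one_mul, Matrix.one_mul, Matrix.mul_one, smul_smul, smul_smul, smul_smul, smul_smul, h1, h2, h3, he, zero_smul,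
    zero_smul, zero_add, add_zero, ← add_smul, sub_add_cancel, one_smul]

/-- … and `s` is invertible when `G` is (inverse `e·1 + (1−e)·G⁻¹`). [cite: Rogawski1990, §3.8 Prop. 3.8.1 (d) p. 30] -/
theorem isUnit_split_idempotent_smul_add {e : R} (he : e * e = e) {G : Matrix n n R} (hGd : IsUnit G.det) :
    IsUnit (e • (1 : Matrix n n R) + (1 - e) • G) := by
  have h1 : (1 - e) * e = 0 := by rw [sub_mul, one_mul, he, sub_self]
  have h2 : e * (1 - e) = 0 := by rw [mul_sub, mul_one, he, sub_self]
  have h3 : (1 - e) * (1 - e) = 1 - e := by rw [mul_sub, mul_one, sub_mul, one_mul, he, sub_self, sub_zero]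
  have hGG : G * G⁻¹ = 1 := Matrix.mul_nonsing_inv G hGd
  have hGG' : G⁻¹ * G = 1 := Matrix.nonsing_inv_mul G hGd
  refine (Matrix.isUnit_iff_isUnit_det _).mpr (Matrix.isUnit_det_of_right_inverse (B := e • (1 : Matrix n n R) + (1 - e) • G⁻¹) ?_)
  rw [Matrix.add_mul, Matrix.mul_add, Matrix.mul_add, Matrix.smul_mul, Matrix.smul_mul, Matrix.smul_mul, Matrix.smul_mul, Matrix.mul_smul,
    Matrix.mul_smul, Matrix.mul_smul, Matrix.mul_smul, Matrix.one_mul, Matrix.one_mul, Matrix.mul_one, smul_smul, smul_smul, smul_smul, smul_smul,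
    he, h1, h2, h3, hGG, zero_smul, zero_smul, add_zero, zero_add, ← add_smul, add_sub_cancel, one_smul]

/-- **Every invertible `σ`-hermitian `G` is a norm `ᵗ(σs) s = twistGram σ 1 s`** (split idempotent present). [cite: Rogawski1990, §3.8 Prop. 3.8.1 (d) p. 30] -/
theorem exists_units_twistGram_one_eq {e : R} (he : e * e = e) (hσe : σ e = 1 - e) {G : Matrix n n R} (hG : (G.map σ)ᵀ = G) (hGd : IsUnit G.det) :
    ∃ s : GL n R, twistGram σ (1 : Matrix n n R) (s : Matrix n n R) = G := by
  refine ⟨(isUnit_split_idempotent_smul_add he hGd).unit, ?_⟩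
  rw [(isUnit_split_idempotent_smul_add he hGd).unit_spec, twistGram_def, Matrix.mul_one,
    transpose_map_mul_self_of_split_idempotent σ he hσe hG]

/-- **ANY TWO invertible `σ`-hermitian matrices of the same size are congruent** when a split idempotent exists: `ᵗ(σt) G t = G′` for some
`t ∈ GL_n(R)` — NO determinant-class condition («`𝓡(T∕F_v)` is trivial at a split place»). [cite: Rogawski1990, §3.8 Prop. 3.8.1 (d) p. 30] -/
theorem exists_units_twistGram_eq_of_split_idempotent {e : R} (he : e * e = e) (hσe : σ e = 1 - e) {G G' : Matrix n n R}
    (hG : (G.map σ)ᵀ = G) (hG' : (G'.map σ)ᵀ = G') (hGd : IsUnit G.det) (hG'd : IsUnit G'.det) :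
    ∃ t : GL n R, twistGram σ G (t : Matrix n n R) = G' := by
  obtain ⟨s, hs⟩ := exists_units_twistGram_one_eq σ he hσe hG hGd
  obtain ⟨s', hs'⟩ := exists_units_twistGram_one_eq σ he hσe hG' hG'd
  refine ⟨s⁻¹ * s', ?_⟩
  rw [← hs, twistGram_def σ (twistGram σ 1 (s : Matrix n n R)), ← twistGram_mul, ← Units.val_mul, mul_inv_cancel_left, hs']

/-- **Rank one: every `σ`-fixed unit is a norm `σ(z) z`** when a split idempotent exists (`z := e + (1 − e) u`).
[cite: Rogawski1990, §3.8 Prop. 3.8.1 (d) p. 30] -/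
theorem exists_isUnit_map_mul_self_eq_of_split_idempotent {e : R} (he : e * e = e) (hσe : σ e = 1 - e) {u : R} (hu : IsUnit u)
    (hσu : σ u = u) : ∃ z : R, IsUnit z ∧ σ z * z = u := by
  have hσe' : σ (1 - e) = e := by rw [map_sub, map_one, hσe, sub_sub_cancel]
  have h1 : (1 - e) * e = 0 := by rw [sub_mul, one_mul, he, sub_self]
  have h3 : (1 - e) * (1 - e) = 1 - e := by rw [mul_sub, mul_one, sub_mul, one_mul, he, sub_self, sub_zero]
  obtain ⟨u', hu'⟩ := hu.exists_right_inv
  refine ⟨e + (1 - e) * u, isUnit_iff_exists_inv.mpr ⟨e + (1 - e) * u', ?_⟩, ?_⟩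
  · calc (e + (1 - e) * u) * (e + (1 - e) * u') = e * e + e * (1 - e) * (u + u') + (1 - e) * (1 - e) * (u * u') := by ring
      _ = 1 := by rw [he, mul_comm e (1 - e), h1, zero_mul, add_zero, h3, hu', mul_one, add_sub_cancel]
  · rw [map_add, map_mul, hσe, hσe', hσu]
    calc (1 - e + e * u) * (e + (1 - e) * u) = (1 - e) * e * (1 + u * u) + (e * e) * u + (1 - e) * (1 - e) * u := by ring
      _ = u := by rw [h1, zero_mul, zero_add, he, h3, ← add_mul, add_sub_cancel, one_mul]

end SplitIdempotent

/-! ## §2 `E_v` at a SPLIT place: the indicator of one factor is a split idempotent -/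

section Local

variable {F : Type} (E : Type) [Field F] [NumberField F] [Field E] [NumberField E] [Algebra F E]
  [Algebra.IsQuadraticExtension F E] (v : HeightOneSpectrum (𝓞 F)) (c : E ≃ₐ[F] E) {δ : E} (hcδ : c δ = -δ) (hδ : δ ≠ 0)

open Literature.NumberTheory.Automorphic.UnitaryGroup

include hcδ hδ in
omit [NumberField F] [Algebra.IsQuadraticExtension F E] in
/-- `c ≠ 1` (it negates `δ ≠ 0`). [folklore] -/
private theorem conj_ne_one : c ≠ 1 := by
  intro h
  apply hδ
  have h2 : δ = -δ := by rw [h, AlgEquiv.one_apply] at hcδ; exact hcδ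
  exact add_self_eq_zero.mp (eq_neg_iff_add_eq_zero.mp h2)

include hcδ hδ in
/-- **The split idempotent of `E_v` at a split place**: for `w ∣ v` with `c • w ≠ w` (so the places above `v` are `w ≠ w̄ = c⁻¹ w`, ★
`PlacesOver.eq_or_eq_galInv`, ★ `PlacesOver.galInv_ne`) the indicator `e = (1_w, 0_w̄)` of the factor `E_w ⊂ E_v = E_w × E_w̄` has `e² = e` and
`(c ⊗ 1) e = 1 − e`. [cite: Mok2014, §1 Notation p. 5] [cite: Rogawski1990, §3.8 Prop. 3.8.1 (d) p. 30] -/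
theorem exists_split_idempotent (w : PlacesOver E v) (hw : c • w.1 ≠ w.1) :
    ∃ e : LocalRing E v, e * e = e ∧ conjLocal E c v e = 1 - e := by
  classical
  have hc : c ≠ 1 := conj_ne_one E c hcδ hδ
  refine ⟨fun w' => if w' = w then 1 else 0, ?_, ?_⟩
  · funext w'
    simp only [Pi.mul_apply]
    split_ifs <;> simp
  · funext w'
    rw [Pi.sub_apply, Pi.one_apply, conjLocal_apply]
    dsimp only
    rcases PlacesOver.eq_or_eq_galInv c hc w w' with rfl | rfl
    · rw [if_neg (PlacesOver.galInv_ne c w' hw), if_pos rfl, map_zero, sub_self]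
    · rw [if_pos (PlacesOver.galInv_galInv c hc w), if_neg (PlacesOver.galInv_ne c w hw), map_one, sub_zero]

include hcδ hδ in
/-- **At a split place, ANY TWO invertible hermitian matrices of the same size over `E_v` are congruent**: `ᵗ(σt) G t = G′`, `t ∈ GL_n(E_v)` —
no determinant class, no signature («`U(G)(F_v) ≅ GL_n(E_w)`», [Mok2014 §1]; «`𝓡(T∕F_v)` is trivial at split `v`»).
[cite: Rogawski1990, §3.8 Prop. 3.8.1 (d) p. 30] [cite: Mok2014, §1 Notation p. 5] -/
theorem exists_units_twistGram_eq_of_split (w : PlacesOver E v) (hw : c • w.1 ≠ w.1) {n : Type*} [Fintype n] [DecidableEq n]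
    {G G' : Matrix n n (LocalRing E v)} (hG : (G.map (conjLocal E c v))ᵀ = G) (hG' : (G'.map (conjLocal E c v))ᵀ = G')
    (hGd : IsUnit G.det) (hG'd : IsUnit G'.det) :
    ∃ t : GL n (LocalRing E v), twistGram (conjLocal E c v) G t.val = G' := by
  obtain ⟨e, he, hσe⟩ := exists_split_idempotent E v c hcδ hδ w hw
  exact exists_units_twistGram_eq_of_split_idempotent _ he hσe hG hG' hGd hG'd

include hcδ hδ in
/-- **At a split place every `σ`-fixed unit of `E_v` is a norm** `σ(z) z` (`F_v^× = N(E_v^×)`). [cite: Rogawski1990, §3.8 Prop. 3.8.1 (d) p. 30] -/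
theorem exists_isUnit_conjLocal_mul_self_eq_of_split (w : PlacesOver E v) (hw : c • w.1 ≠ w.1) {u : LocalRing E v} (hu : IsUnit u)
    (hσu : conjLocal E c v u = u) : ∃ z : LocalRing E v, IsUnit z ∧ conjLocal E c v z * z = u := by
  obtain ⟨e, he, hσe⟩ := exists_split_idempotent E v c hcδ hδ w hw
  exact exists_isUnit_map_mul_self_eq_of_split_idempotent _ he hσe hu hσu

/-! ## §3 (h2) The `γ`-centralising congruence and `U(H)(F_v)`-conjugacy at a singular class, `v` SPLIT -/

/-- `⊕ᶠ` is injective in the pair of blocks. [folklore] -/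
private theorem finSum_inj {S : Type*} [CommRing S] {N₁ N₂ : ℕ} {A C : Matrix (Fin N₁) (Fin N₁) S} {B D : Matrix (Fin N₂) (Fin N₂) S}
    (h : finSum N₁ N₂ A B = finSum N₁ N₂ C D) : A = C ∧ B = D := by
  have h' := (Matrix.reindex finSumFinEquiv finSumFinEquiv).injective h
  obtain ⟨hA, -, -, hB⟩ := Matrix.fromBlocks_inj.mp h'
  exact ⟨hA, hB⟩

/-- The blocks of a hermitian block-diagonal matrix are hermitian. [folklore] -/
private theorem blocks_hermitian' {S : Type*} [CommRing S] (σ : S →+* S) {N₁ N₂ : ℕ} {G₁ : Matrix (Fin N₁) (Fin N₁) S}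
    {G₂ : Matrix (Fin N₂) (Fin N₂) S} (h : ((finSum N₁ N₂ G₁ G₂).map σ)ᵀ = finSum N₁ N₂ G₁ G₂) :
    (G₁.map σ)ᵀ = G₁ ∧ (G₂.map σ)ᵀ = G₂ := by
  rw [transpose_finSum_map] at h
  exact finSum_inj h

include hcδ hδ in
/-- **(h2) A `γ`-CENTRALISING CONGRUENCE over `E_v`, `v` SPLIT — no determinant condition.**  Frame `P` of `γ` (`γ P = P (a·1₂ ⊕ᶠ b·1₁)`),
hermitian invertible `G, G′` block diagonal in the frame (`ᵗ(σP) G P = G₁ ⊕ᶠ G₂`, `ᵗ(σP) G′ P = G′₁ ⊕ᶠ G′₂`).  Then some `t ∈ GL₃(E_v)` commutes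
with `γ` and `ᵗ(σt) G t = G′`: the blocks are hermitian with unit determinants, hence congruent at a split place (§2), and ★
`exists_commute_twistGram_eq_of_blocks` assembles.  (The NON-split twin ★ `exists_commute_twistGram_eq_of_det_blocks` needs `hdet₁ hdet₂`.)
[cite: Rogawski1990, §3.8 Prop. 3.8.1 (d) p. 30] [cite: Kottwitz1986, §7] -/
theorem exists_commute_twistGram_eq_of_split (w : PlacesOver E v) (hw : c • w.1 ≠ w.1)
    {γ G G' : Matrix (Fin (2 + 1)) (Fin (2 + 1)) (LocalRing E v)} {P : GL (Fin (2 + 1)) (LocalRing E v)} {a b : LocalRing E v}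
    (hG : (G.map (conjLocal E c v))ᵀ = G) (hG' : (G'.map (conjLocal E c v))ᵀ = G') (hGd : IsUnit G.det) (hG'd : IsUnit G'.det)
    (hγP : γ * P.val = P.val *
      finSum 2 1 (a • (1 : Matrix (Fin 2) (Fin 2) (LocalRing E v))) (b • (1 : Matrix (Fin 1) (Fin 1) (LocalRing E v))))
    {G₁ G'₁ : Matrix (Fin 2) (Fin 2) (LocalRing E v)} {G₂ G'₂ : Matrix (Fin 1) (Fin 1) (LocalRing E v)}
    (hGP : twistGram (conjLocal E c v) G P.val = finSum 2 1 G₁ G₂)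
    (hG'P : twistGram (conjLocal E c v) G' P.val = finSum 2 1 G'₁ G'₂) :
    ∃ t : GL (Fin (2 + 1)) (LocalRing E v),
      t.val * γ = γ * t.val ∧
        twistGram (conjLocal E c v) G t.val = G' := by
  have hσ : ∀ x, conjLocal E c v (conjLocal E c v x) = x := Liu2021.LemD1OfPlace.conjLocal_conjLocal_apply E v c hcδ hδ
  -- the blocks are hermitian with unit determinants
  have hPG : ((twistGram (conjLocal E c v) G P.val).map (conjLocal E c v))ᵀ = twistGram (conjLocal E c v) G P.val :=
    conjTranspose_twistGram _ _ hσ hG _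
  have hPG' : ((twistGram (conjLocal E c v) G' P.val).map (conjLocal E c v))ᵀ = twistGram (conjLocal E c v) G' P.val :=
    conjTranspose_twistGram _ _ hσ hG' _
  rw [hGP] at hPG
  rw [hG'P] at hPG'
  obtain ⟨h₁, h₂⟩ := blocks_hermitian' (conjLocal E c v) hPG
  obtain ⟨h'₁, h'₂⟩ := blocks_hermitian' (conjLocal E c v) hPG'
  have hdG : G₁.det * G₂.det = conjLocal E c v P.val.det * G.det * P.val.det := by rw [← det_finSum, ← hGP, det_twistGram]
  have hdG' : G'₁.det * G'₂.det = conjLocal E c v P.val.det * G'.det * P.val.det := by rw [← det_finSum, ← hG'P, det_twistGram]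
  have hPd : IsUnit P.val.det := Matrix.isUnits_det_units P
  have hprod : IsUnit (G₁.det * G₂.det) := hdG ▸ ((hPd.map (conjLocal E c v)).mul hGd).mul hPd
  have hprod' : IsUnit (G'₁.det * G'₂.det) := hdG' ▸ ((hPd.map (conjLocal E c v)).mul hG'd).mul hPd
  -- congruences of the blocks at a split place, assembled
  obtain ⟨t₁, ht₁⟩ := exists_units_twistGram_eq_of_split E v c hcδ hδ w hw h₁ h'₁ (isUnit_of_mul_isUnit_left hprod)
    (isUnit_of_mul_isUnit_left hprod')
  obtain ⟨t₂, ht₂⟩ := exists_units_twistGram_eq_of_split E v c hcδ hδ w hw h₂ h'₂ (isUnit_of_mul_isUnit_right hprod)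
    (isUnit_of_mul_isUnit_right hprod')
  exact exists_commute_twistGram_eq_of_blocks (conjLocal E c v) hγP hGP hG'P t₁ ht₁ t₂ ht₂

include hcδ hδ in
/-- **(h2) LOCAL CONJUGACY AT A SINGULAR CLASS, `v` SPLIT: conjugates of `γ` in `U(H)(F_v)` whose transported forms are block diagonal in the frame
are `U(H)(F_v)`-CONJUGATE — unconditionally.**  `H` hermitian invertible over `E_v`, frame `P` of `γ`, conjugators `g γ g⁻¹ = δ′`, `g′ γ g′⁻¹ = δ″`
with `ᵗ(σP) H_g P = G₁ ⊕ᶠ G₂`, `ᵗ(σP) H_{g′} P = G′₁ ⊕ᶠ G′₂` (automatic for `δ′, δ″ ∈ U(H)`: ★ `exists_twistGram_frame_eq_finSum`); then `δ″ = u⁻¹ δ′ u` for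
some `u ∈ U(H)(F_v)` (★ R1 `exists_unitary_conj_of_twistGram_eq`).  The NON-split twin ★ `exists_unitary_conj_of_det_blocks` needs the rank-2
block-determinant class `hdet₁`; at a split place there is no invariant (cf. ★ `isConj_of_exists_conj_of_split`: stable conjugacy = conjugacy).
[cite: Rogawski1990, §3.8 Prop. 3.8.1 (d) p. 30; §3.1 p. 19] [cite: Kottwitz1986, §7] -/
theorem exists_unitary_conj_of_split_frame (w : PlacesOver E v) (hw : c • w.1 ≠ w.1)
    {H : Matrix (Fin (2 + 1)) (Fin (2 + 1)) (LocalRing E v)} (hH : (H.map (conjLocal E c v))ᵀ = H) (hHd : IsUnit H.det)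
    {γ δ' δ'' g g' P : GL (Fin (2 + 1)) (LocalRing E v)} {a b : LocalRing E v} (hg : g * γ * g⁻¹ = δ') (hg' : g' * γ * g'⁻¹ = δ'')
    (hγP : γ.val * P.val =
      P.val *
        finSum 2 1 (a • (1 : Matrix (Fin 2) (Fin 2) (LocalRing E v))) (b • (1 : Matrix (Fin 1) (Fin 1) (LocalRing E v))))
    {G₁ G'₁ : Matrix (Fin 2) (Fin 2) (LocalRing E v)} {G₂ G'₂ : Matrix (Fin 1) (Fin 1) (LocalRing E v)}
    (hGP : twistGram (conjLocal E c v) (twistGram (conjLocal E c v) H g.val)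
      P.val = finSum 2 1 G₁ G₂)
    (hG'P : twistGram (conjLocal E c v) (twistGram (conjLocal E c v) H g'.val)
      P.val = finSum 2 1 G'₁ G'₂) :
    ∃ u : GL (Fin (2 + 1)) (LocalRing E v), u ∈ unitaryGroup (conjLocal E c v) H ∧ u * δ'' * u⁻¹ = δ' := by
  have hσ : ∀ x, conjLocal E c v (conjLocal E c v x) = x := Liu2021.LemD1OfPlace.conjLocal_conjLocal_apply E v c hcδ hδ
  have hgd : IsUnit g.val.det := Matrix.isUnits_det_units g
  have hg'd : IsUnit g'.val.det := Matrix.isUnits_det_units g'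
  have hG : ((twistGram (conjLocal E c v) H g.val).map (conjLocal E c v))ᵀ = twistGram (conjLocal E c v) H g.val :=
    conjTranspose_twistGram _ _ hσ hH _
  have hG' : ((twistGram (conjLocal E c v) H g'.val).map (conjLocal E c v))ᵀ = twistGram (conjLocal E c v) H g'.val :=
    conjTranspose_twistGram _ _ hσ hH _
  have hGd : IsUnit (twistGram (conjLocal E c v) H g.val).det := by
    rw [det_twistGram]; exact ((hgd.map (conjLocal E c v)).mul hHd).mul hgd
  have hG'd : IsUnit (twistGram (conjLocal E c v) H g'.val).det := by
    rw [det_twistGram]; exact ((hg'd.map (conjLocal E c v)).mul hHd).mul hg'd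
  obtain ⟨t, htγ, htG⟩ := exists_commute_twistGram_eq_of_split E v c hcδ hδ w hw hG hG' hGd hG'd hγP hGP hG'P
  refine exists_unitary_conj_of_twistGram_eq (conjLocal E c v) H hg hg' (Units.ext htγ) ?_
  rw [Units.val_mul, twistGram_mul, ← twistGram_def, htG]

end Local

end Literature.NumberTheory.Rogawski1990

end
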